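import Mathlib
import Summits.MatrixMultiplication.Statement
import Summits.MatrixMultiplication.MatrixMultiplication.Theses.NOFWindowCapacity

/-!
# Crux `Thesis` (stmt-MatrixMultiplication-7270) — `Lines/birth.lean`, the BC3 birth skeleton

Route `NOFWindowCapacity` (route-MatrixMultiplication-NOFWindowCapacity), crux #0 `Thesis` (X itself: for every
`ε > 0` an abelian host `G`, legs `s t u : Fin N → G` (`N ≥ 2`) and a PARTITION of the `N³` matrix-multiplication
triples into `B` alien-free boxes with `B·|G| ≤ N^(2+ε)`).

Decomposition = the route's own foreseen two-layer split (route header, TWO-LAYER PLAN: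
"Thesis ⇐ EntangledWindows → TilingFromCapacity → Thesis"), typed:

* `stub_entangledWindows` (XL, OPEN — the CAPACITY horn; by name the route's rank-2 crux `EntangledWindows`,
  item stmt-MatrixMultiplication-7271, and NECESSARY for `Thesis` by the proved support `ThesisNeedsEntangled`):
  for every `η > 0` ONE alien-free box holding `≥ N^(3-η)` MM triples in a host of order `≤ N^(2+η)`.
* `stub_tilingFromCapacity` (L, OPEN — the TILING principle, the protocol formalism's extra demand "partitioned,
  not just met"): the pigeonhole lower bound `B ≥ N³ / (window capacity)` on the number of boxes of an alien-free
  partition is achievable up to `N^(o(1))` under linear accounting — a window with `≥ N^β` cells in a host of order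
  `≤ N^α` yields, for every `η > 0`, an alien-free PARTITION (some `N' ≥ 2`, some abelian host `G'`, one set of
  legs) of cost `B·|G'| ≤ N'^(α + 3 - β + η)`.  Sanity of the typing: in the non-entangled regime `β ≤ α + η` the
  exponent is `≥ 3` and the one-box TPP host `(ℤ_N)³` (cost `N³`) witnesses it, so the stub has bite exactly for
  windows with more than `N^η·|G|` cells; for a block window `A × M × C` (TPP, `|A||M||C| = N^β ≤ |G|`,
  SingleBlockBound) the `N³/N^β` index-translates of the block with legs factored through the block coordinate
  partition `[N]³` alien-freely in the SAME host at cost exactly `|G|·N³/N^β`; for a symmetric STPP window of `k`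
  blocks the `k²` re-pairings `(A_p, B_{p+d}, C_{p+e})` do the same.  The open content is the entangled regime
  `β > α`, where index-translates of a window are NOT alien-free for the same legs (alien-freeness is not invariant
  under independent relabelings of the three leg sets), so a tiling must come with the window's construction.

`Thesis_of` composes the two stub SIGNATURES into the crux BY NAME with a real proof (choose `η = ε/3`, take the
window at `η`, tile it with `α = 2 + η`, `β = 3 - η`: exponent `(2+η) + 3 - (3-η) + η = 2 + ε`); `Thesis_closed`
instantiates it with the stubs (`closed = false` only through `stub_*`).  Disproof used: no `Disproof.lean` and no
landed `Negative/` lemma exist for this crux (ledger crux ls, 2026-08-17); `ledger negatives --problem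
MatrixMultiplication` (7 entries) has nothing on alien-free windows / NOF partitions.  The in-route refuting driver is
`WindowCapacityGap` (rank 3) via the proved `GapKillsThesis`; it would kill `stub_entangledWindows` first
(`ThesisNeedsEntangled`), which is the honest bet of the line.
-/

set_option linter.dupNamespace false

namespace Summit.MatrixMultiplication.MatrixMultiplication.Cruxes.Thesis.Birth

open Summit.MatrixMultiplication.MatrixMultiplication.Theses.NOFWindowCapacity

/-- STUB 1 — the capacity horn, BY NAME the route's rank-2 crux `EntangledWindows` (stmt-MatrixMultiplication-7271):
`∀ η > 0, ∃ N ≥ 2`, a finite abelian `G` with `|G| ≤ N^(2+η)`, legs `s t u : Fin N → G` and ONE alien-free box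
`(P, Q, R)` holding at least `N^(3-η)` matrix-multiplication triples.  Necessary for `Thesis`
(`ThesisNeedsEntangled`, proved in Theorems); closes by `exact` of whatever proves item 7271. -/
theorem stub_entangledWindows : EntangledWindows := by
  sorry

/-- STUB 2 — tiling from capacity (partition number `≈ N³ / capacity` up to `N^(o(1))`, linear accounting): an
alien-free window with at least `N^β` MM triples in a finite abelian host of order at most `N^α` (`N ≥ 2`) yields,
for every `η > 0`, some `N' ≥ 2`, a finite abelian host `G'`, ONE set of legs `s' t' u' : Fin N' → G'` and `B`
alien-free boxes PARTITIONING the `N'³` MM triples with `B·|G'| ≤ N'^(α + 3 - β + η)`. -/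
theorem stub_tilingFromCapacity :
    ∀ α β η : ℝ, 0 < η →
      ∀ (N : ℕ) (G : Type) [AddCommGroup G] [Fintype G] (s t u : Fin N → G)
        (P Q R : Finset (Fin N × Fin N)),
        (∀ a ∈ P, ∀ b ∈ Q, ∀ c ∈ R, (t b.2 - s b.1) + (u c.2 - t c.1) = u a.2 - s a.1 →
            a.1 = b.1 ∧ b.2 = c.1 ∧ a.2 = c.2) →
        2 ≤ N →
        (Fintype.card G : ℝ) ≤ (N : ℝ) ^ α →
        (N : ℝ) ^ β ≤ ((Finset.univ.filter (fun x : Fin N × Fin N × Fin N =>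
            (x.1, x.2.2) ∈ P ∧ (x.1, x.2.1) ∈ Q ∧ (x.2.1, x.2.2) ∈ R)).card : ℝ) →
        ∃ N' : ℕ, 2 ≤ N' ∧ ∃ (G' : Type) (_ : AddCommGroup G') (_ : Fintype G')
          (s' t' u' : Fin N' → G') (B : ℕ) (P' Q' R' : Fin B → Finset (Fin N' × Fin N')),
          (∀ r : Fin B, ∀ a ∈ P' r, ∀ b ∈ Q' r, ∀ c ∈ R' r,
              (t' b.2 - s' b.1) + (u' c.2 - t' c.1) = u' a.2 - s' a.1 →
              a.1 = b.1 ∧ b.2 = c.1 ∧ a.2 = c.2) ∧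
          (∀ i j k : Fin N', ∃! r : Fin B, (i, k) ∈ P' r ∧ (i, j) ∈ Q' r ∧ (j, k) ∈ R' r) ∧
          ((B * Fintype.card G' : ℕ) : ℝ) ≤ (N' : ℝ) ^ (α + 3 - β + η) := by
  sorry

/-- COMPOSITION (real proof, no `sorry` of its own): the two stub SIGNATURES imply the crux `Thesis` BY NAME.
Given `ε > 0` put `η = ε / 3`; the capacity horn gives a window with `≥ N^(3-η)` cells in a host of order
`≤ N^(2+η)`; tiling it with `α = 2 + η`, `β = 3 - η` gives an alien-free partition of cost
`≤ N'^((2+η) + 3 - (3-η) + η) = N'^(2+ε)`. -/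
theorem Thesis_of :
    EntangledWindows →
    (∀ α β η : ℝ, 0 < η →
      ∀ (N : ℕ) (G : Type) [AddCommGroup G] [Fintype G] (s t u : Fin N → G)
        (P Q R : Finset (Fin N × Fin N)),
        (∀ a ∈ P, ∀ b ∈ Q, ∀ c ∈ R, (t b.2 - s b.1) + (u c.2 - t c.1) = u a.2 - s a.1 →
            a.1 = b.1 ∧ b.2 = c.1 ∧ a.2 = c.2) →
        2 ≤ N →
        (Fintype.card G : ℝ) ≤ (N : ℝ) ^ α →
        (N : ℝ) ^ β ≤ ((Finset.univ.filter (fun x : Fin N × Fin N × Fin N =>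
            (x.1, x.2.2) ∈ P ∧ (x.1, x.2.1) ∈ Q ∧ (x.2.1, x.2.2) ∈ R)).card : ℝ) →
        ∃ N' : ℕ, 2 ≤ N' ∧ ∃ (G' : Type) (_ : AddCommGroup G') (_ : Fintype G')
          (s' t' u' : Fin N' → G') (B : ℕ) (P' Q' R' : Fin B → Finset (Fin N' × Fin N')),
          (∀ r : Fin B, ∀ a ∈ P' r, ∀ b ∈ Q' r, ∀ c ∈ R' r,
              (t' b.2 - s' b.1) + (u' c.2 - t' c.1) = u' a.2 - s' a.1 →
              a.1 = b.1 ∧ b.2 = c.1 ∧ a.2 = c.2) ∧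
          (∀ i j k : Fin N', ∃! r : Fin B, (i, k) ∈ P' r ∧ (i, j) ∈ Q' r ∧ (j, k) ∈ R' r) ∧
          ((B * Fintype.card G' : ℕ) : ℝ) ≤ (N' : ℝ) ^ (α + 3 - β + η)) →
    Thesis := by
  intro hEW hTile ε hε
  have hη : (0 : ℝ) < ε / 3 := by positivity
  obtain ⟨N, hN, G, instG, instF, s, t, u, P, Q, R, hAF, hG, hcells⟩ := hEW (ε / 3) hη
  obtain ⟨N', hN', G', instG', instF', s', t', u', B, P', Q', R', hAF', hPart', hcost⟩ :=
    hTile (2 + ε / 3) (3 - ε / 3) (ε / 3) hη N G s t u P Q R hAF hN hG hcells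
  refine ⟨N', hN', G', instG', instF', s', t', u', B, P', Q', R', hAF', hPart', ?_⟩
  have hexp : (2 + ε / 3) + 3 - (3 - ε / 3) + ε / 3 = 2 + ε := by ring
  simpa only [hexp] using hcost

/-- The crux BY NAME from the registered stubs (`closed = false` only through `stub_*`). -/
theorem Thesis_closed : Thesis :=
  Thesis_of stub_entangledWindows stub_tilingFromCapacity

end Summit.MatrixMultiplication.MatrixMultiplication.Cruxes.Thesis.Birth
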